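import Summits.CriticalPhenomena.PercolationContinuityZ3.Theorems.PercAnnulusCrossingIICTailTrivial
import Summits.CriticalPhenomena.PercolationContinuityZ3.Theorems.PercAnnulusCrossingIICBorelCantelli
import HarnessLib

/-!
# Asymptotically far events of probability `≥ c` recur almost surely under a tail-trivial measure — Kesten's IIC (lane RSW3, p1 gen 14)

builds on p205010 (kernel theorem, internal audit signed; external expert review pending) — used only through `θ(p_c) = 0` in the
`criticalProbI` / `ℤ²` corollaries (via gen 10's tail triviality of the IIC); the main theorems are about ANY tail-trivial probability
measure on bond configurations of `ℤ^d`.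

Seat `prim-rsw3-p1` (gen 14); memo `run/shared/lean/prim/rsw3/P1-QM.md` §27.  Helper file for the crux `stmt-CriticalPhenomena-4575`
chain; no definitions, no sorries.

A sequence of events `U_k` is ASYMPTOTICALLY FAR (inline, no definition) if for every box `Λ(K)` and every `δ > 0`, for all large `k`
there is a measurable `W ∈ 𝓕_{Λ(K)ᶜ}` (determined by the pairs off `Λ(K).sym2`) with `ν(U_k Δ W) ≤ δ`.  Under a TAIL-TRIVIAL `ν`
(Georgii's Prop. 7.9 in the lane's form, gen 10 `exists_forall_abs_real_inter_sub_mul_le_of_isTailTrivial`: for every event `A`,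
`sup_{G ∈ 𝓕_{Λ(K)ᶜ}} |ν(A ∩ G) − ν(A)ν(G)| → 0`):

* **`eventually_real_inter_le_of_isTailTrivial`** — asymptotically far events DECORRELATE from every fixed event:
  `ν(A ∩ U_k) ≤ ν(A)ν(U_k) + δ` for all large `k`;
* **`ae_frequently_mem_of_isTailTrivial`** — **asymptotically far events with `ν(U_k) ≥ c > 0` (eventually) occur infinitely often,
  `ν`-almost surely** (gen 14's second Borel–Cantelli lemma with decorrelated witnesses, `…IICBorelCantelli`);
  `ae_frequently_mem_of_isTailTrivial_of_determinedBy` — the case of events exactly determined off growing boxes;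
* IIC forms: `iicMeasure_ae_frequently_mem` (`θ(p) = 0`, (A2)□ at aspect `(s,L)`, `2 ≤ s`), **`iicMeasure_ae_frequently_mem_criticalProbI`**
  (`p_c(ℤ^d)`, `d ≥ 2`), **`iicMeasure_ae_frequently_mem_Z2`** (Kesten's planar IIC, unconditional).

This is the abstract half of gen 14's theme: every single-scale lower bound `ν(U_k) ≥ c` for a geometrically receding family of events
of the IIC (visits of far balls, fat far volumes, far patterns on the cluster, …) upgrades to an almost-sure recurrence statement.
References: H.-O. Georgii, *Gibbs Measures and Phase Transitions* (2011), Prop. 7.9; H. Kesten, PTRF 73 (1986) Thm. (3); D. Basu,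
A. Sapozhnikov, ECP 22 (2017) no. 26; S. Kochen, C. Stone, Ill. J. Math. 8 (1964).
-/

noncomputable section

namespace Summit.CriticalPhenomena.PercolationContinuityZ3.Theorems.Crossing

open MeasureTheory Filter Topology Literature.Probability.Percolation Literature.Probability.LatticeModels
open Literature.Probability.Percolation.DCT16
open Summit.CriticalPhenomena.PercolationContinuityZ3.Theorems.SurfaceTension
open scoped Literature.Probability.Percolation ENNReal symmDiff

variable {d : ℕ}

/-! ## Decorrelation of asymptotically far events under tail triviality -/

/-- `|ν(A ∩ U) − ν(A ∩ W)| ≤ ν(U Δ W)` for null-measurable `U, W`. [folklore] -/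
theorem abs_real_inter_sub_real_inter_le_real_symmDiff (ν : Measure (BondConfig (Site d))) [IsFiniteMeasure ν]
    (A : Set (BondConfig (Site d))) {U W : Set (BondConfig (Site d))} (hU : MeasurableSet U) (hW : MeasurableSet W) (hA : MeasurableSet A) :
    |ν.real (A ∩ U) - ν.real (A ∩ W)| ≤ ν.real (U ∆ W) := by
  refine (abs_measureReal_sub_le_measureReal_symmDiff (hA.inter hU).nullMeasurableSet (hA.inter hW).nullMeasurableSet).trans ?_
  rw [← Set.inter_symmDiff_distrib_left]
  exact measureReal_mono Set.inter_subset_right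

/-- **Asymptotically far events decorrelate from every fixed event under a tail-trivial measure**: if `ν` is tail trivial, `U_k` are
measurable and for every `K`, `δ' > 0` eventually some measurable `W ∈ 𝓕_{Λ(K)ᶜ}` has `ν(U_k Δ W) ≤ δ'`, then for every event `A` and
`δ > 0`: `ν(A ∩ U_k) ≤ ν(A)·ν(U_k) + δ` for all large `k`. [cite: Georgii2011, Prop. 7.9] -/
theorem eventually_real_inter_le_of_isTailTrivial {ν : Measure (BondConfig (Site d))} [IsProbabilityMeasure ν]
    (hT : IsTailTrivial (V := Sym2 (Site d)) (S := Prop) ν) (U : ℕ → Set (BondConfig (Site d)))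
    (hU : ∀ k, MeasurableSet (U k))
    (hfar : ∀ (K : ℕ) (δ : ℝ), 0 < δ → ∀ᶠ k in atTop, ∃ W : Set (BondConfig (Site d)), MeasurableSet W ∧
      DeterminedBy W {e : Sym2 (Site d) | e ∉ (↑((box d K).sym2) : Set (Sym2 (Site d)))} ∧ ν.real (U k ∆ W) ≤ δ)
    {A : Set (BondConfig (Site d))} (hA : MeasurableSet A) {δ : ℝ} (hδ : 0 < δ) :
    ∀ᶠ k in atTop, ν.real (A ∩ U k) ≤ ν.real A * ν.real (U k) + δ := by
  have hδ3 : 0 < δ / 3 := by positivity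
  obtain ⟨K, hK⟩ := exists_forall_abs_real_inter_sub_mul_le_of_isTailTrivial hT hA hδ3
  filter_upwards [hfar K (δ / 3) hδ3] with k hk
  obtain ⟨W, hWm, hWd, hUW⟩ := hk
  have h1 := abs_le.1 (hK W hWm hWd)
  have h2 := abs_le.1 ((abs_real_inter_sub_real_inter_le_real_symmDiff ν A (hU k) hWm hA).trans hUW)
  have h3 := abs_le.1 ((abs_measureReal_sub_le_measureReal_symmDiff (hU k).nullMeasurableSet hWm.nullMeasurableSet).trans hUW)
  have hA1 : ν.real A ≤ 1 := measureReal_le_one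
  have hA0 : 0 ≤ ν.real A := measureReal_nonneg
  nlinarith [h1.1, h1.2, h2.1, h2.2, h3.1, h3.2, mul_le_mul_of_nonneg_left (show ν.real W ≤ ν.real (U k) + δ / 3 by linarith) hA0]

/-- **Asymptotically far events of probability `≥ c` recur almost surely under a tail-trivial measure**: `ν` tail trivial, `U_k`
measurable and asymptotically far (for every `K`, `δ > 0`, eventually `ν(U_k Δ W) ≤ δ` for some measurable `W ∈ 𝓕_{Λ(K)ᶜ}`), and
`ν(U_k) ≥ c > 0` for all large `k` ⇒ `ν`-a.s. `ω ∈ U_k` for infinitely many `k` (second Borel–Cantelli with decorrelated witnesses).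
[cite: Georgii2011, Prop. 7.9] -/
theorem ae_frequently_mem_of_isTailTrivial {ν : Measure (BondConfig (Site d))} [IsProbabilityMeasure ν]
    (hT : IsTailTrivial (V := Sym2 (Site d)) (S := Prop) ν) (U : ℕ → Set (BondConfig (Site d)))
    (hU : ∀ k, MeasurableSet (U k))
    (hfar : ∀ (K : ℕ) (δ : ℝ), 0 < δ → ∀ᶠ k in atTop, ∃ W : Set (BondConfig (Site d)), MeasurableSet W ∧
      DeterminedBy W {e : Sym2 (Site d) | e ∉ (↑((box d K).sym2) : Set (Sym2 (Site d)))} ∧ ν.real (U k ∆ W) ≤ δ)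
    {c : ℝ} (hc : 0 < c) (hcU : ∀ᶠ k in atTop, c ≤ ν.real (U k)) :
    ∀ᵐ ω ∂ν, ∃ᶠ k in atTop, ω ∈ U k := by
  refine ae_frequently_mem_of_forall_exists_decorrelated ν U hc fun F hF δ hδ M => ?_
  have hev : ∀ᶠ k in atTop, c ≤ ν.real (U k) ∧ M ≤ k ∧ ∀ A ∈ F, ν.real (A ∩ U k) ≤ ν.real A * ν.real (U k) + δ :=
    hcU.and ((eventually_ge_atTop M).and
      ((F.eventually_all).2 fun A hA => eventually_real_inter_le_of_isTailTrivial hT U hU hfar (hF A hA) hδ))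
  obtain ⟨k, hkc, hkM, hk⟩ := hev.exists
  exact ⟨k, hkM, U k, subset_rfl, hU k, hkc, hk⟩

/-- **Events exactly determined off growing boxes**: `ν` tail trivial, `U_k` measurable with, for every `K`, `U_k ∈ 𝓕_{Λ(K)ᶜ}` for all
large `k`, and `ν(U_k) ≥ c > 0` eventually ⇒ `U_k` infinitely often, `ν`-a.s. (the witness is `U_k` itself).
[cite: Georgii2011, Prop. 7.9] -/
theorem ae_frequently_mem_of_isTailTrivial_of_determinedBy {ν : Measure (BondConfig (Site d))} [IsProbabilityMeasure ν]
    (hT : IsTailTrivial (V := Sym2 (Site d)) (S := Prop) ν) (U : ℕ → Set (BondConfig (Site d)))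
    (hU : ∀ k, MeasurableSet (U k))
    (hfar : ∀ K : ℕ, ∀ᶠ k in atTop, DeterminedBy (U k) {e : Sym2 (Site d) | e ∉ (↑((box d K).sym2) : Set (Sym2 (Site d)))})
    {c : ℝ} (hc : 0 < c) (hcU : ∀ᶠ k in atTop, c ≤ ν.real (U k)) :
    ∀ᵐ ω ∂ν, ∃ᶠ k in atTop, ω ∈ U k := by
  refine ae_frequently_mem_of_isTailTrivial hT U hU (fun K δ hδ => ?_) hc hcU
  filter_upwards [hfar K] with k hk
  refine ⟨U k, hU k, hk, ?_⟩
  rw [symmDiff_self, Set.bot_eq_empty, measureReal_empty]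
  exact hδ.le

/-! ## Kesten's IIC -/

/-- **Asymptotically far events of IIC-probability `≥ c` recur `ν`-a.s.** (`θ(p) = 0`, (A2)□ at aspect `(s,L)` with `2 ≤ s`, `0 < p`,
`d ≥ 1`, `ν` any IIC probability measure — tail trivial by gen 10's `iicMeasure_isTailTrivial_of_setToSetQuasiMultAspectAt`).
[cite: Georgii2011, Prop. 7.9] [cite: BasuSapozhnikov2017ECP, Thm. 1.1] [cite: Kesten1986, Thm. (3)] -/
theorem iicMeasure_ae_frequently_mem (hd : 1 ≤ d) (p : unitInterval) (hp : 0 < (p : ℝ))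
    (hθ : theta (zdGraph d) 0 p = 0) {s L : ℕ} (hs : 2 ≤ s) {ϰ : ℝ} (hϰ : 0 < ϰ) (hA2 : SetToSetQuasiMultAspectAt d p s L ϰ)
    {ν : Measure (BondConfig (Site d))} [IsProbabilityMeasure ν]
    (hν : ∀ (F : Finset (Sym2 (Site d))) (E : Set (BondConfig (Site d))), MeasurableSet E → DeterminedBy E ↑F →
      Tendsto (fun n : ℕ => (bondPercolation (zdGraph d) p).real (E ∩ siteToBoundary d n) / oneArmProb d p n)
        atTop (𝓝 (ν.real E)))
    (U : ℕ → Set (BondConfig (Site d))) (hU : ∀ k, MeasurableSet (U k))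
    (hfar : ∀ (K : ℕ) (δ : ℝ), 0 < δ → ∀ᶠ k in atTop, ∃ W : Set (BondConfig (Site d)), MeasurableSet W ∧
      DeterminedBy W {e : Sym2 (Site d) | e ∉ (↑((box d K).sym2) : Set (Sym2 (Site d)))} ∧ ν.real (U k ∆ W) ≤ δ)
    {c : ℝ} (hc : 0 < c) (hcU : ∀ᶠ k in atTop, c ≤ ν.real (U k)) :
    ∀ᵐ ω ∂ν, ∃ᶠ k in atTop, ω ∈ U k :=
  ae_frequently_mem_of_isTailTrivial (iicMeasure_isTailTrivial_of_setToSetQuasiMultAspectAt hd p hp hθ hs hϰ hA2 hν) U hU hfar hc hcU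

/-- **At `p_c(ℤ^d)` (`d ≥ 2`, (A2)□ at aspect `(s,L)`, `2 ≤ s`): asymptotically far events with IIC-probability `≥ c > 0` eventually
occur infinitely often, `ν`-almost surely, for every IIC probability measure `ν`.** [cite: Georgii2011, Prop. 7.9]
[cite: BasuSapozhnikov2017ECP, Thm. 1.1] [cite: Kesten1986, Thm. (3)] -/
theorem iicMeasure_ae_frequently_mem_criticalProbI (hd : 2 ≤ d) {s L : ℕ} (hs : 2 ≤ s) {ϰ : ℝ} (hϰ : 0 < ϰ)
    (hA2 : SetToSetQuasiMultAspectAt d (criticalProbI d) s L ϰ)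
    {ν : Measure (BondConfig (Site d))} [IsProbabilityMeasure ν]
    (hν : ∀ (F : Finset (Sym2 (Site d))) (E : Set (BondConfig (Site d))), MeasurableSet E → DeterminedBy E ↑F →
      Tendsto (fun n : ℕ => (bondPercolation (zdGraph d) (criticalProbI d)).real (E ∩ siteToBoundary d n) /
        oneArmProb d (criticalProbI d) n) atTop (𝓝 (ν.real E)))
    (U : ℕ → Set (BondConfig (Site d))) (hU : ∀ k, MeasurableSet (U k))
    (hfar : ∀ (K : ℕ) (δ : ℝ), 0 < δ → ∀ᶠ k in atTop, ∃ W : Set (BondConfig (Site d)), MeasurableSet W ∧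
      DeterminedBy W {e : Sym2 (Site d) | e ∉ (↑((box d K).sym2) : Set (Sym2 (Site d)))} ∧ ν.real (U k ∆ W) ≤ δ)
    {c : ℝ} (hc : 0 < c) (hcU : ∀ᶠ k in atTop, c ≤ ν.real (U k)) :
    ∀ᵐ ω ∂ν, ∃ᶠ k in atTop, ω ∈ U k :=
  ae_frequently_mem_of_isTailTrivial (iicMeasure_isTailTrivial_criticalProbI hd hs hϰ hA2 hν) U hU hfar hc hcU

/-- **Kesten's planar IIC, unconditionally**: for every probability measure `ν` with the IIC limit property at `p_c(ℤ²)`, asymptotically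
far events with `ν(U_k) ≥ c > 0` eventually occur infinitely often `ν`-a.s. [cite: Georgii2011, Prop. 7.9] [cite: Kesten1986, Thm. (3)] -/
theorem iicMeasure_ae_frequently_mem_Z2 {ν : Measure (BondConfig (Site 2))} [IsProbabilityMeasure ν]
    (hν : ∀ (F : Finset (Sym2 (Site 2))) (E : Set (BondConfig (Site 2))), MeasurableSet E → DeterminedBy E ↑F →
      Tendsto (fun n : ℕ => (bondPercolation (zdGraph 2) (criticalProbI 2)).real (E ∩ siteToBoundary 2 n) /
        oneArmProb 2 (criticalProbI 2) n) atTop (𝓝 (ν.real E)))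
    (U : ℕ → Set (BondConfig (Site 2))) (hU : ∀ k, MeasurableSet (U k))
    (hfar : ∀ (K : ℕ) (δ : ℝ), 0 < δ → ∀ᶠ k in atTop, ∃ W : Set (BondConfig (Site 2)), MeasurableSet W ∧
      DeterminedBy W {e : Sym2 (Site 2) | e ∉ (↑((box 2 K).sym2) : Set (Sym2 (Site 2)))} ∧ ν.real (U k ∆ W) ≤ δ)
    {c : ℝ} (hc : 0 < c) (hcU : ∀ᶠ k in atTop, c ≤ ν.real (U k)) :
    ∀ᵐ ω ∂ν, ∃ᶠ k in atTop, ω ∈ U k :=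
  ae_frequently_mem_of_isTailTrivial (iicMeasure_isTailTrivial_Z2 hν) U hU hfar hc hcU

end Summit.CriticalPhenomena.PercolationContinuityZ3.Theorems.Crossing

end
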